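import Literature.Probability.LatticeModels.ScaleFrameKernelPaths
import Literature.Probability.LatticeModels.ScaleFrameQuasiMultUpper
import Literature.Probability.LatticeModels.ScaleFrameQuasiMultGlue
import HarnessLib

/-!
# Kesten's kernel on a scale frame: geometry of the gap exploration (proved)

Topic `Literature/Probability/LatticeModels` (trunk `StatMech`, family `crit-ising`). Bookkeeping for
the cross-ratio bound of the chain kernel of Kesten's ratio-limit scheme (H. Kesten, PTRF 73 (1986),
§2, Lemma (23); D. Basu, A. Sapozhnikov, ECP 22 (2017), §2, eq. (2.9)) on an abstract `ScaleFrame`: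
the GAP annulus `(b, bM)` between an inner exploration datum `(U', R')` (radii `< aM^m + η`) and an
outer context (an event of the edges beyond radius `aM^{m+16+g}`, a target `R` out there) is
explored from OUTSIDE (`BlockExploration*.lean`: inner set `Rest = outSet b (bM)`, block
`Blk = annSet b (bM)`, explored set `X`, rim `Y`).

* radii: the rim `Y` consists of good vertices of radius in `(b - η, b]` (`rad_of_mem_explRim_out`),
  the complement of `X` of good vertices of radius `< bM` (`good_of_not_mem_explSet_out`), the good
  vertices of `X` have radius `> b` (`lt_rad_of_mem_explSet_out`), so that no frame edge at a good
  vertex of radius `≤ b - η` touches `X` (`not_mem_explSet_out_of_adj`);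
* `ScaleFrame.gapTerm_mem_iff` — the event algebra of one term of the kernel: on the off-wired gap
  datum event of `(X, Y)` the context event "`R' ↔ R` inside `Wo ∖ U'`" splits
  (`openCrossing_iff_of_explEventOff`) into the crossing `R' ↔ Y` inside `W = (U' ∪ X)ᶜ`, read on
  the edges off `X`, and an outer piece read on the edges touching `X`; all readings of the datum
  event on edge sets containing the edges touching `X` agree (`explEventOff_iff_of_agree`).

Everything is proved; no definitions, no named facts.

## References

* [Kesten1986] H. Kesten, *Probab. Theory Related Fields* 73 (1986) 369–394, §2, Lemma (23).
* [BasuSapozhnikov2017ECP] D. Basu, A. Sapozhnikov, *Electron. Commun. Probab.* 22 (2017) no. 26,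
  §2, eq. (2.3) and eq. (2.9).
-/

noncomputable section

open scoped Classical
open MeasureTheory Finset SimpleGraph
open Literature.Probability.Percolation (BondConfig openConnIn openCrossing explSet explRim explEvent
  mem_explRim_iff explSet_subset subset_explSet explRim_disjoint mem_explEvent_iff openConnIn_mono)

namespace Literature.Probability.LatticeModels

namespace ScaleFrame

variable {V : Type*} [Fintype V] [DecidableEq V] (F : ScaleFrame V)

/-! ### Radii around the gap exploration -/

/-- A good explored vertex of the exploration of `annSet b b'` from `outSet b b'` has radius `> b`.
[cite: Kesten1986, §2 Lemma (23)] -/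
theorem lt_rad_of_mem_explSet_out {b b' : ℝ} {ω : BondConfig V} {v : V}
    (hv : v ∈ explSet (F.outSet b b') (F.annSet b b') ω) (hg : v ∈ F.good) : b < F.rad v := by
  rcases explSet_subset _ _ ω hv with h | h
  · exact not_le.1 fun hle => h (Or.inl ⟨hg, hle⟩)
  · exact h.2.1

/-- A vertex NOT explored by the exploration of `annSet b b'` from `outSet b b'` (`b < b'`) is good
of radius `< b'`. [cite: Kesten1986, §2 Lemma (23)] -/
theorem good_of_not_mem_explSet_out {b b' : ℝ} (hbb : b < b') {ω : BondConfig V} {v : V}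
    (hv : v ∉ explSet (F.outSet b b') (F.annSet b b') ω) : v ∈ F.good ∧ F.rad v < b' := by
  have hvR : v ∉ F.outSet b b' := fun h => hv (subset_explSet _ _ ω h)
  rcases not_not.1 (mt F.mem_outSet.2 hvR) with ⟨hg, h⟩ | ⟨hg, -, h⟩
  · exact ⟨hg, h.trans_lt hbb⟩
  · exact ⟨hg, h⟩

/-- **The rim of the gap exploration lies just inside scale `b`**: a rim vertex of the exploration of
`annSet b b'` from `outSet b b'` (`b < b' ≤ Rmax`, configuration of frame edges) is good with radius in
`(b - η, b]`: it lies in `inSet b` and carries a frame edge to a good explored vertex, of radius `> b`.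
[cite: Kesten1986, §2 Lemma (23)] -/
theorem rad_of_mem_explRim_out {b b' : ℝ} (hbb : b < b') (hb' : b' ≤ F.Rmax) {ω : BondConfig V}
    (hωE : ω ⊆ (↑F.E : Set (Sym2 V))) {y : V}
    (hy : y ∈ explRim (F.outSet b b') (F.annSet b b') ω) :
    y ∈ F.good ∧ b - F.η < F.rad y ∧ F.rad y ≤ b := by
  obtain ⟨-, x, hx, hxy⟩ := mem_explRim_iff.1 hy
  have hyIB := explRim_disjoint hy
  obtain ⟨h1, h2⟩ := not_or.1 hyIB
  have hy' : y ∈ F.inSet b := (not_not.1 (mt F.mem_outSet.2 h1)).resolve_right h2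
  obtain ⟨hxg, hxr⟩ := F.adj_good _ (hωE hxy) y (Sym2.mem_mk_right x y) x (Sym2.mem_mk_left x y)
    hy'.1 (by linarith [hy'.2])
  have hbx := F.lt_rad_of_mem_explSet_out hx hxg
  exact ⟨hy'.1, by linarith [(abs_lt.1 hxr).2], hy'.2⟩

/-- **No frame edge at a low good vertex touches the explored set of the gap**: along a frame edge at
a good vertex `u` with `rad u + η ≤ b` (and `rad u < Rmax`) the radius stays `≤ b`, so the far
endpoint is not explored. [cite: Kesten1986, §2 Lemma (23)] -/
theorem not_mem_explSet_out_of_adj {b b' : ℝ} {ω : BondConfig V} {e : Sym2 V} (he : e ∈ F.E)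
    {u v : V} (hu : u ∈ e) (hv : v ∈ e) (hug : u ∈ F.good) (hur : F.rad u + F.η ≤ b)
    (huR : F.rad u < F.Rmax) : v ∉ explSet (F.outSet b b') (F.annSet b b') ω := by
  intro hvX
  obtain ⟨hvg, hvr⟩ := F.adj_good e he u hu v hv hug huR
  have := F.lt_rad_of_mem_explSet_out hvX hvg
  linarith [(abs_lt.1 hvr).2]

/-- A good vertex of radius `≤ b` is not explored by the gap exploration. [cite: Kesten1986, §2 Lemma (23)] -/
theorem not_mem_explSet_out_of_rad_le {b b' : ℝ} {ω : BondConfig V} {v : V} (hg : v ∈ F.good)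
    (hr : F.rad v ≤ b) : v ∉ explSet (F.outSet b b') (F.annSet b b') ω :=
  fun hv => absurd (F.lt_rad_of_mem_explSet_out hv hg) (not_lt.2 hr)

/-! ### Scales -/

/-- The scales of the gap: `aM^m + η ≤ aM^{m+1}`, `aM^{m+1} M^{14} = aM^{m+15}`,
`aM^{m+15} + a ≤ aM^{m+15} M = aM^{m+16} ≤ aM^{m+16+g} ≤ Rmax` (`a > 0`, `M ≥ 4`, `η ≤ a`).
[folklore] -/
theorem gap_scales {a M : ℝ} {m g : ℕ} (ha : 0 < a) (hM : 4 ≤ M)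
    (hR : a * M ^ (m + 16 + g) ≤ F.Rmax) (hη : F.η ≤ a) :
    a * M ^ m + F.η ≤ a * M ^ (m + 1) ∧ a * M ^ (m + 1) * M ^ 14 = a * M ^ (m + 15) ∧
      a * M ^ (m + 15) + a ≤ a * M ^ (m + 15) * M ∧ a * M ^ (m + 15) * M = a * M ^ (m + 16) ∧
      a * M ^ (m + 16) ≤ a * M ^ (m + 16 + g) ∧ a * M ^ (m + 16) ≤ F.Rmax ∧ 0 < a * M ^ (m + 15) := by
  have h1 := scale_gap ha hM (Nat.lt_add_one m)
  have h2 := scale_gap ha hM (Nat.lt_add_one (m + 15))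
  have h3 : a * M ^ (m + 16) ≤ a * M ^ (m + 16 + g) := scale_mono ha hM (Nat.le_add_right _ _)
  have hM0 : 0 < M := by linarith
  refine ⟨by linarith, by ring, ?_, by ring, h3, h3.trans hR, by positivity⟩
  calc a * M ^ (m + 15) + a ≤ a * M ^ (m + 15 + 1) := h2
    _ = a * M ^ (m + 15) * M := by ring

/-- The outer context region lies in the unexplored-from-outside inner set of the gap exploration:
`outSet (aM^{m+16}) (aM^{m+16+g}) ⊆ outSet (aM^{m+15}) (aM^{m+15} M)` (`g ≥ 1`).
[cite: Kesten1986, §2 Lemma (23)] -/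
theorem outSet_far_subset_rest {a M : ℝ} {m g : ℕ} (ha : 0 < a) (hM : 4 ≤ M) (hg : 1 ≤ g) :
    F.outSet (a * M ^ (m + 16)) (a * M ^ (m + 16 + g)) ⊆
      F.outSet (a * M ^ (m + 15)) (a * M ^ (m + 15) * M) := by
  have h1 := scale_gap ha hM (show m + 16 < m + 16 + g by omega)
  have h2 := scale_gap ha hM (Nat.lt_add_one (m + 15))
  have h3 : a * M ^ (m + 15 + 1) = a * M ^ (m + 15) * M := by ring
  refine F.outSet_subset_outSet (by linarith) (by linarith) ?_
  rw [← h3]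
  exact scale_mono ha hM (by omega)

/-! ### The event algebra of one term of the kernel -/

/-- **One term of the kernel, as an event.** Gap exploration of `annSet b (bM)` from
`Rest = outSet b (bM)`, `b = aM^{m+15}`, with datum `(X, Y)` realised by a configuration of frame
edges; inner datum `(U', R')` of radii `< aM^m + η` with `R' ∩ U' = ∅`; outer region
`Wo ⊇ {good, rad < aM^{m+16+g}}` and target `R ⊆ Wo ∩ outSet (aM^{m+16}) (aM^{m+16+g})`; readings on
sets of frame pairs `T ⊆ E₁` such that the pairs of `E₁` touching `X` are exactly those of `T`. Then
for every configuration `ω`: [`ω ∩ E₁` realises the off-wired datum `(X, Y)`, has an open crossing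
`R' ↔ R` inside `Wo ∖ U'`, and `ω ∈ Fo₁`] iff [`ω ∩ T` realises the off-wired datum, `ω ∈ Fo₁`, some
rim vertex carries an open `T`-edge to a vertex of `X` joined to `R` inside `X ∩ Wo` by open
`T`-edges, and `ω ∩ (E₁ ∖ T)` has an open crossing `R' ↔ Y` inside `(U' ∪ X)ᶜ`].
[cite: BasuSapozhnikov2017ECP, §2 eq. (2.9)] -/
theorem gapTerm_mem_iff {a M : ℝ} {m g : ℕ} (ha : 0 < a) (hM : 4 ≤ M) (hg : 1 ≤ g)
    (hR : a * M ^ (m + 16 + g) ≤ F.Rmax) (hη : F.η ≤ a)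
    {U' R' : Set V} (hU' : ∀ v ∈ U', v ∈ F.good ∧ F.rad v < a * M ^ m)
    (hR' : ∀ v ∈ R', v ∈ F.good ∧ F.rad v < a * M ^ m + F.η) (hRU : ∀ r ∈ R', r ∉ U')
    {Wo R : Set V} (hWo : ∀ v : V, v ∈ F.good → F.rad v < a * M ^ (m + 16 + g) → v ∈ Wo)
    (hRR : R ⊆ Wo ∩ F.outSet (a * M ^ (m + 16)) (a * M ^ (m + 16 + g)))
    (Fo₁ : Set (BondConfig V)) {E₁ T : Set (Sym2 V)} (hTE : T ⊆ E₁)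
    {X Y : Set V} (hT : ∀ e ∈ E₁, (∃ v ∈ X, v ∈ e) → e ∈ T) (hT' : ∀ e ∈ T, ∃ v ∈ X, v ∈ e)
    {ω₀ : BondConfig V} (hω₀ : ω₀ ⊆ (↑F.E : Set (Sym2 V)))
    (hX : explSet (F.outSet (a * M ^ (m + 15)) (a * M ^ (m + 15) * M))
      (F.annSet (a * M ^ (m + 15)) (a * M ^ (m + 15) * M)) ω₀ = X)
    (hY : explRim (F.outSet (a * M ^ (m + 15)) (a * M ^ (m + 15) * M))
      (F.annSet (a * M ^ (m + 15)) (a * M ^ (m + 15) * M)) ω₀ = Y) (ω : BondConfig V) :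
    let Rest : Set V := F.outSet (a * M ^ (m + 15)) (a * M ^ (m + 15) * M)
    let Blk : Set V := F.annSet (a * M ^ (m + 15)) (a * M ^ (m + 15) * M)
    (ω ∈ {ω : BondConfig V | ω ∩ E₁ ∈ explEvent Rest Blk X Y ∩
        {ω | ∀ r ∈ Y, ∀ r₂ ∈ Y, ∃ v ∈ X \ Rest, ∃ v' ∈ X \ Rest,
          s(v, r) ∈ ω ∧ s(v', r₂) ∈ ω ∧ ω ∈ openConnIn (X \ Rest) v v'}} ∩
      ({ω | ω ∩ E₁ ∈ openCrossing (Wo \ U') R' R} ∩ Fo₁)) ↔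
    ω ∈ {ω : BondConfig V | ω ∩ T ∈ explEvent Rest Blk X Y ∩
        {ω | ∀ r ∈ Y, ∀ r₂ ∈ Y, ∃ v ∈ X \ Rest, ∃ v' ∈ X \ Rest,
          s(v, r) ∈ ω ∧ s(v', r₂) ∈ ω ∧ ω ∈ openConnIn (X \ Rest) v v'}} ∩
      (Fo₁ ∩ {ω | ∃ y ∈ Y, ∃ v ∈ X, s(v, y) ∈ ω ∩ T ∧ ω ∩ T ∈ openCrossing (X ∩ Wo) {v} R}) ∩
      {ω | ω ∩ (E₁ \ T) ∈ openCrossing {v | v ∉ U' ∧ v ∉ X} R' Y} := by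
  intro Rest Blk
  obtain ⟨hs1, -, hs3, hs4, hs5, hs6, hbpos⟩ := F.gap_scales ha hM hR hη
  have hηpos := F.η_pos
  have hbb : a * M ^ (m + 15) < a * M ^ (m + 15) * M := by linarith
  have hb'R : a * M ^ (m + 15) * M ≤ F.Rmax := hs4 ▸ hs6
  have hmb : a * M ^ m + F.η + F.η ≤ a * M ^ (m + 15) := by
    have := scale_gap ha hM (show m + 1 < m + 15 by omega)
    linarith
  -- geometry of the datum
  have hYrad : ∀ y ∈ Y, y ∈ F.good ∧ a * M ^ (m + 15) - F.η < F.rad y ∧ F.rad y ≤ a * M ^ (m + 15) :=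
    fun y hy => F.rad_of_mem_explRim_out hbb hb'R hω₀ (hY ▸ hy)
  have hYX : ∀ y ∈ Y, y ∉ X := fun y hy hyX => by
    rw [← hY] at hy; rw [← hX] at hyX
    exact (mem_explRim_iff.1 hy).1 hyX
  have hnX : ∀ v, v ∉ X → v ∈ F.good ∧ F.rad v < a * M ^ (m + 15) * M := fun v hv =>
    F.good_of_not_mem_explSet_out hbb (hX ▸ hv)
  have hWo' : ∀ v, v ∉ X → v ∈ Wo := fun v hv =>
    hWo v (hnX v hv).1 (by linarith [(hnX v hv).2])
  have hU'X : ∀ u ∈ U', u ∉ X := fun u hu =>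
    hX ▸ F.not_mem_explSet_out_of_rad_le (hU' u hu).1 (by linarith [(hU' u hu).2])
  have hR'X : ∀ r ∈ R', r ∉ X := fun r hr =>
    hX ▸ F.not_mem_explSet_out_of_rad_le (hR' r hr).1 (by linarith [(hR' r hr).2])
  have hYU' : ∀ y ∈ Y, y ∉ U' := fun y hy hyU => by
    have := (hYrad y hy).2.1
    linarith [(hU' y hyU).2]
  have hRestX : Rest ⊆ X := hX ▸ subset_explSet Rest Blk ω₀
  have hXRB : X ⊆ Rest ∪ Blk := hX ▸ explSet_subset Rest Blk ω₀
  have hOut : F.outSet (a * M ^ (m + 16)) (a * M ^ (m + 16 + g)) ⊆ Rest :=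
    F.outSet_far_subset_rest ha hM hg
  -- hypotheses of the splitting lemma, with `Z := Wo ∖ U'`
  have hYZ : Y ⊆ Wo \ U' := fun y hy =>
    ⟨hWo y (hYrad y hy).1 (by linarith [(hYrad y hy).2.2]), hYU' y hy⟩
  have hXZ : X \ Rest ⊆ Wo \ U' := fun v hv => by
    have hvB : v ∈ Blk := ((hXRB hv.1).resolve_left hv.2)
    exact ⟨hWo v hvB.1 (by linarith [hvB.2.2]), fun hvU => hU'X v hvU hv.1⟩
  have hA : R' ⊆ (Wo \ U') \ X := fun r hr =>
    ⟨⟨hWo r (hR' r hr).1 (by linarith [(hR' r hr).2]), hRU r hr⟩, hR'X r hr⟩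
  have hB : R ⊆ X ∩ (Wo \ U') := fun r hr =>
    ⟨hRestX (hOut (hRR hr).2), (hRR hr).1, fun hrU => hU'X r hrU (hRestX (hOut (hRR hr).2))⟩
  have hZX : (Wo \ U') \ X = {v | v ∉ U' ∧ v ∉ X} := Set.ext fun v =>
    ⟨fun h => ⟨h.1.2, h.2⟩, fun h => ⟨⟨hWo' v h.2, h.1⟩, h.2⟩⟩
  have hXZ' : X ∩ (Wo \ U') = X ∩ Wo := Set.ext fun v =>
    ⟨fun h => ⟨h.1, h.2.1⟩, fun h => ⟨h.1, h.2, fun hvU => hU'X v hvU h.1⟩⟩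
  -- the two readings agree on the pairs touching `X`
  have hagT : ∀ e : Sym2 V, (∃ v ∈ X, v ∈ e) → (e ∈ ω ∩ E₁ ↔ e ∈ ω ∩ T) := fun e he =>
    ⟨fun h => ⟨h.1, hT e h.2 he⟩, fun h => ⟨h.1, hTE h.2⟩⟩
  have hagX : ∀ {S : Set V} {c d : V}, S ⊆ X → (ω ∩ E₁ ∈ openConnIn S c d ↔ ω ∩ T ∈ openConnIn S c d) :=
    fun hS => ⟨fun h => Percolation.BlockExploration.openConnIn_of_agree h fun c hc d _ hcd =>
        (hagT _ ⟨c, hS hc, Sym2.mem_mk_left c d⟩).1 hcd,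
      fun h => Percolation.BlockExploration.openConnIn_of_agree h fun c hc d _ hcd =>
        (hagT _ ⟨c, hS hc, Sym2.mem_mk_left c d⟩).2 hcd⟩
  constructor
  · rintro ⟨hG, hC, hFo⟩
    obtain ⟨h1, y, hy, v, hv, hvy, hcr⟩ :=
      (openCrossing_iff_of_explEventOff hG.1 hG.2 hYZ hXZ hA hB).1 hC
    refine ⟨⟨(explEventOff_iff_of_agree hagT).1 hG, hFo, y, hy, v, hv,
      (hagT _ ⟨v, hv, Sym2.mem_mk_left v y⟩).1 hvy, ?_⟩, ?_⟩
    · rw [hXZ'] at hcr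
      obtain ⟨x, hx, r, hr, hxr⟩ := hcr
      exact ⟨x, hx, r, hr, (hagX Set.inter_subset_left).1 hxr⟩
    · rw [hZX] at h1
      obtain ⟨x, hx, y', hy', hxy⟩ := h1
      refine ⟨x, hx, y', hy', Percolation.BlockExploration.openConnIn_of_agree hxy
        fun c hc d hd hcd => ⟨hcd.1, hcd.2, fun hT0 => ?_⟩⟩
      obtain ⟨w, hwX, hw⟩ := hT' _ hT0
      rcases Sym2.mem_iff.1 hw with rfl | rfl
      exacts [hc.2 hwX, hd.2 hwX]
  · rintro ⟨⟨hGT, hFo, y, hy, v, hv, hvy, hcr⟩, hIn⟩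
    have hG := (explEventOff_iff_of_agree hagT).2 hGT
    refine ⟨hG, (openCrossing_iff_of_explEventOff hG.1 hG.2 hYZ hXZ hA hB).2
      ⟨?_, y, hy, v, hv, (hagT _ ⟨v, hv, Sym2.mem_mk_left v y⟩).2 hvy, ?_⟩, hFo⟩
    · rw [hZX]
      obtain ⟨x, hx, y', hy', hxy⟩ := hIn
      exact ⟨x, hx, y', hy', Percolation.isUpperSet_openConnIn _ x y'
        (Set.inter_subset_inter_right ω Set.sdiff_subset) hxy⟩
    · rw [hXZ']
      obtain ⟨x, hx, r, hr, hxr⟩ := hcr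
      exact ⟨x, hx, r, hr, (hagX Set.inter_subset_left).2 hxr⟩

/-! ### The gap datum realised by a configuration of frame edges: the facts used downstream -/

/-- **Geometry of a realised gap datum.** With `b = aM^{m+15}`, `Rest = outSet b (bM)`,
`Blk = annSet b (bM)`, an inner datum `(U', R')` of radii `< aM^m + η`, and a gap datum `(X, Y)`
realised by a configuration of frame edges: `Rest ⊆ X ⊆ Rest ∪ Blk`; the rim `Y` consists of good
vertices of radius in `(b - η, b]`, off `X` and off `U'`; vertices off `X` are good of radius `< bM`;
no frame edge touching `X` touches `U'` or lies inside `inSet (b / M³)`; `R'` misses `X`; the band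
`{good, aM^{m+1} < rad < aM^{m+1} M^{14}}` misses `U' ∪ X`; and the two regions of the
quasi-multiplicativity bricks for `W = (U' ∪ X)ᶜ` depend on `U'` alone, resp. on `X` alone.
[cite: Kesten1986, §2 Lemma (23)] -/
theorem gap_datum_facts {a M : ℝ} {m g : ℕ} (ha : 0 < a) (hM : 4 ≤ M)
    (hR : a * M ^ (m + 16 + g) ≤ F.Rmax) (hη : F.η ≤ a)
    {U' R' : Set V} (hU' : ∀ v ∈ U', v ∈ F.good ∧ F.rad v < a * M ^ m)
    (hR' : ∀ v ∈ R', v ∈ F.good ∧ F.rad v < a * M ^ m + F.η)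
    {X Y : Set V} {ω₀ : BondConfig V} (hω₀ : ω₀ ⊆ (↑F.E : Set (Sym2 V)))
    (hX : explSet (F.outSet (a * M ^ (m + 15)) (a * M ^ (m + 15) * M))
      (F.annSet (a * M ^ (m + 15)) (a * M ^ (m + 15) * M)) ω₀ = X)
    (hY : explRim (F.outSet (a * M ^ (m + 15)) (a * M ^ (m + 15) * M))
      (F.annSet (a * M ^ (m + 15)) (a * M ^ (m + 15) * M)) ω₀ = Y) :
    F.outSet (a * M ^ (m + 15)) (a * M ^ (m + 15) * M) ⊆ X ∧
    X ⊆ F.outSet (a * M ^ (m + 15)) (a * M ^ (m + 15) * M) ∪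
      F.annSet (a * M ^ (m + 15)) (a * M ^ (m + 15) * M) ∧
    (∀ y ∈ Y, y ∈ F.good ∧ a * M ^ (m + 15) - F.η < F.rad y ∧ F.rad y ≤ a * M ^ (m + 15)) ∧
    (∀ y ∈ Y, y ∉ X) ∧ (∀ y ∈ Y, y ∉ U') ∧
    (∀ v : V, v ∉ X → v ∈ F.good ∧ F.rad v < a * M ^ (m + 15) * M) ∧
    (∀ e ∈ F.E, (∃ v ∈ X, v ∈ e) → ∀ u ∈ e, u ∉ U') ∧
    (∀ e ∈ F.E, (∃ v ∈ X, v ∈ e) → e ∉ F.edgesWithin (F.inSet (a * M ^ (m + 15) / M ^ 3))) ∧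
    (∀ r ∈ R', r ∉ X) ∧
    (∀ v : V, v ∈ F.good → a * M ^ (m + 1) < F.rad v → F.rad v < a * M ^ (m + 1) * M ^ 14 →
      v ∉ U' ∧ v ∉ X) ∧
    {v | v ∉ U' ∧ v ∉ X} ∩ {v | F.rad v < a * M ^ (m + 1) * M ^ 6} =
      {v | v ∈ F.good ∧ v ∉ U' ∧ F.rad v < a * M ^ (m + 1) * M ^ 6} ∧
    {v | v ∉ U' ∧ v ∉ X} ∩ {v | a * M ^ (m + 1) * M ^ 8 < F.rad v} =
      {v | v ∉ X ∧ a * M ^ (m + 1) * M ^ 8 < F.rad v} := by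
  obtain ⟨hs1, hs2, hs3, hs4, -, hs6, hbpos⟩ := F.gap_scales ha hM hR hη
  have hηpos := F.η_pos
  have hM1 : (1 : ℝ) ≤ M := by linarith
  have hbb : a * M ^ (m + 15) < a * M ^ (m + 15) * M := by linarith
  have hb'R : a * M ^ (m + 15) * M ≤ F.Rmax := hs4 ▸ hs6
  have h1_15 : a * M ^ (m + 1) + a ≤ a * M ^ (m + 15) := scale_gap ha hM (by omega)
  have h7_15 : a * M ^ (m + 1) * M ^ 6 ≤ a * M ^ (m + 15) := by
    rw [mul_assoc, ← pow_add]; exact scale_mono ha hM (by omega)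
  have h0_8 : a * M ^ m ≤ a * M ^ (m + 1) * M ^ 8 := by
    rw [mul_assoc, ← pow_add]; exact scale_mono ha hM (by omega)
  have hdiv : a * M ^ (m + 15) / M ^ 3 ≤ a * M ^ (m + 15) :=
    div_le_self hbpos.le (one_le_pow₀ hM1)
  have hYrad : ∀ y ∈ Y, y ∈ F.good ∧ a * M ^ (m + 15) - F.η < F.rad y ∧
      F.rad y ≤ a * M ^ (m + 15) := fun y hy => F.rad_of_mem_explRim_out hbb hb'R hω₀ (hY ▸ hy)
  have hlow : ∀ v : V, v ∈ F.good → F.rad v ≤ a * M ^ (m + 15) → v ∉ X := fun v hg hr =>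
    hX ▸ F.not_mem_explSet_out_of_rad_le hg hr
  have hU'X : ∀ u ∈ U', u ∉ X := fun u hu => hlow u (hU' u hu).1 (by linarith [(hU' u hu).2])
  refine ⟨hX ▸ subset_explSet _ _ ω₀, hX ▸ explSet_subset _ _ ω₀, hYrad, fun y hy hyX => ?_,
    fun y hy hyU => ?_, fun v hv => F.good_of_not_mem_explSet_out hbb (hX ▸ hv),
    fun e he ⟨v, hvX, hve⟩ u hue huU => ?_, fun e he ⟨v, hvX, hve⟩ heW => ?_,
    fun r hr => hlow r (hR' r hr).1 (by linarith [(hR' r hr).2]), fun v hg h1 h2 => ?_,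
    Set.ext fun v => ⟨fun h => ⟨(F.good_of_not_mem_explSet_out hbb (hX ▸ h.1.2)).1, h.1.1, h.2⟩,
      fun h => ⟨⟨h.2.1, hlow v h.1 (by linarith [h.2.2])⟩, h.2.2⟩⟩,
    Set.ext fun v => ⟨fun h => ⟨h.1.2, h.2⟩, fun h => ⟨⟨fun hvU => ?_, h.1⟩, h.2⟩⟩⟩
  · rw [← hY] at hy; rw [← hX] at hyX
    exact (mem_explRim_iff.1 hy).1 hyX
  · have := (hYrad y hy).2.1
    linarith [(hU' y hyU).2]
  · exact (hX ▸ F.not_mem_explSet_out_of_adj he hue hve (hU' u huU).1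
      (by linarith [(hU' u huU).2]) (by linarith [(hU' u huU).2])) hvX
  · have hv := (F.mem_edgesWithin.1 heW).2 v hve
    exact hlow v hv.1 (hv.2.trans hdiv) hvX
  · exact ⟨fun hvU => by linarith [(hU' v hvU).2], hlow v hg (by rw [hs2] at h2; exact h2.le)⟩
  · linarith [(hU' v hvU).2, h.2]

/-! ### Graphs and readings -/

omit [Fintype V] in
/-- Deleting the diagonal pairs, or pairs already deleted, does not change the spanned graph: the
environment graph of the kernel off the edges `T'` touching the inner datum. [folklore] -/
theorem fromEdgeSet_sdiff_eq (E T' : Finset (Sym2 V)) :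
    fromEdgeSet (↑(E \ T') : Set (Sym2 V)) =
      fromEdgeSet (↑((E.filter fun e => ¬ e.IsDiag) \ T') : Set (Sym2 V)) := by
  ext u v
  simp only [fromEdgeSet_adj, Finset.coe_sdiff, Finset.coe_filter, Set.mem_sdiff, Set.mem_setOf_eq,
    Finset.mem_coe, Sym2.mk_isDiag_iff]
  tauto

/-- **The graph of the quasi-multiplicativity bricks**: the genuine frame edges touching neither
`U'` nor `X` span the same graph as the frame edges inside `W = (U' ∪ X)ᶜ`. [folklore] -/
theorem fromEdgeSet_gap_inner_eq (U' X : Set V) :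
    fromEdgeSet (↑((((F.E.filter fun e => ¬ e.IsDiag) \
        (F.E.filter fun e => ¬ e.IsDiag ∧ ∃ v ∈ U', v ∈ e)) \
          (F.E.filter fun e => ¬ e.IsDiag ∧ ∃ v ∈ X, v ∈ e))) : Set (Sym2 V)) =
      fromEdgeSet (↑(F.edgesWithin {v | v ∉ U' ∧ v ∉ X}) : Set (Sym2 V)) := by
  ext u w
  simp only [fromEdgeSet_adj, Finset.mem_coe, Finset.mem_sdiff, Finset.mem_filter,
    Sym2.mk_isDiag_iff, Sym2.mem_iff, F.mem_edgesWithin, Set.mem_setOf_eq]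
  constructor
  · rintro ⟨⟨⟨⟨hE, -⟩, h1⟩, h3⟩, hne⟩
    refine ⟨⟨hE, fun v hv => ?_⟩, hne⟩
    rcases hv with rfl | rfl
    · exact ⟨fun hu => h1 ⟨hE, hne, _, hu, Or.inl rfl⟩, fun hu => h3 ⟨hE, hne, _, hu, Or.inl rfl⟩⟩
    · exact ⟨fun hu => h1 ⟨hE, hne, _, hu, Or.inr rfl⟩, fun hu => h3 ⟨hE, hne, _, hu, Or.inr rfl⟩⟩
  · rintro ⟨⟨hE, hW⟩, hne⟩
    refine ⟨⟨⟨⟨hE, hne⟩, ?_⟩, ?_⟩, hne⟩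
    · rintro ⟨-, -, v, hvU, (rfl | rfl)⟩
      exacts [(hW _ (Or.inl rfl)).1 hvU, (hW _ (Or.inr rfl)).1 hvU]
    · rintro ⟨-, -, v, hvX, (rfl | rfl)⟩
      exacts [(hW _ (Or.inl rfl)).2 hvX, (hW _ (Or.inr rfl)).2 hvX]

/-- **Reading an event on the edge set of the graph does not change its probability**: under
`φ^B_{⟨S⟩}` almost every configuration is contained in `S`. [cite: Grimmett2006, §1.2 eq. (1.2)] -/
theorem rcMeasure_real_read_self {p q : ℝ} (hp : p ∈ Set.Icc (0 : ℝ) 1) (hq : 0 < q)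
    (S : Finset (Sym2 V)) (B : Set V) (A C : Set (BondConfig V)) :
    (rcMeasure (fromEdgeSet (↑S : Set (Sym2 V))) p q B).real ({ω | ω ∩ ↑S ∈ A} ∩ C) =
      (rcMeasure (fromEdgeSet (↑S : Set (Sym2 V))) p q B).real (A ∩ C) := by
  refine measureReal_congr (rcMeasure_ae_eq_of_forall_subset_edgeSet _ hp hq B fun ω hω => ?_)
  have h : ω ∩ ↑S = ω := Set.inter_eq_left.2 fun e he => by
    have := hω he
    rw [edgeSet_fromEdgeSet] at this
    exact this.1
  simp only [Set.mem_inter_iff, Set.mem_setOf_eq, h]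

/-- **The gap datum event read on the frame edges and read on the genuine frame edges touching `X`
have the same probability** under any measure of frame edges: lattice configurations agree with their
restriction on every pair touching `X`. [cite: BasuSapozhnikov2017ECP, §2 eq. (2.9)] -/
theorem rcMeasure_real_gapDatum_read {p q : ℝ} (hp : p ∈ Set.Icc (0 : ℝ) 1) (hq : 0 < q)
    (S : Finset (Sym2 V)) (hS : S ⊆ F.E) (B : Set V) (Rest Blk X Y : Set V) (C : Set (BondConfig V)) :
    (rcMeasure (fromEdgeSet (↑S : Set (Sym2 V))) p q B).real
        ({ω | ω ∩ (↑F.E : Set (Sym2 V)) ∈ explEvent Rest Blk X Y ∩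
          {ω | ∀ r ∈ Y, ∀ r₂ ∈ Y, ∃ v ∈ X \ Rest, ∃ v' ∈ X \ Rest,
            s(v, r) ∈ ω ∧ s(v', r₂) ∈ ω ∧ ω ∈ openConnIn (X \ Rest) v v'}} ∩ C) =
      (rcMeasure (fromEdgeSet (↑S : Set (Sym2 V))) p q B).real
        ({ω | ω ∩ (↑(F.E.filter fun e => ¬ e.IsDiag ∧ ∃ v ∈ X, v ∈ e) : Set (Sym2 V)) ∈
          explEvent Rest Blk X Y ∩
          {ω | ∀ r ∈ Y, ∀ r₂ ∈ Y, ∃ v ∈ X \ Rest, ∃ v' ∈ X \ Rest,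
            s(v, r) ∈ ω ∧ s(v', r₂) ∈ ω ∧ ω ∈ openConnIn (X \ Rest) v v'}} ∩ C) := by
  refine measureReal_congr (rcMeasure_ae_eq_of_forall_subset_edgeSet _ hp hq B fun ω hω => ?_)
  have hωE : ∀ e ∈ ω, e ∈ F.E ∧ ¬ e.IsDiag := fun e he => by
    have := hω he
    rw [edgeSet_fromEdgeSet] at this
    exact ⟨hS this.1, this.2⟩
  rw [Set.mem_inter_iff, Set.mem_inter_iff, Set.mem_setOf_eq, Set.mem_setOf_eq,
    explEventOff_iff_of_agree (ω₂ := ω ∩ ↑(F.E.filter fun e => ¬ e.IsDiag ∧ ∃ v ∈ X, v ∈ e))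
      fun e he => ?_]
  simp only [Set.mem_inter_iff, Finset.mem_coe, Finset.mem_filter]
  exact ⟨fun h => ⟨h.1, h.2, (hωE e h.1).2, he⟩, fun h => ⟨h.1, h.2.1⟩⟩

end ScaleFrame

end Literature.Probability.LatticeModels

end
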